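import Literature.MathematicalPhysics.QuantumFieldTheory.Balaban1983to89.T4WeightBudget

/-!
# `Balaban1983to89.T4GlobalDenominator` — the relative weight bound of node U5c extracted from ABSOLUTE bounds
against a GLOBAL lower bound on the full sum (the fixed-torus route), and the absolute bad mass of a product gas
(cell `pub-balaban`, T4-DAG §5 row T4-U5c.E-NE7b-PROVE-P2f* (self-row, §8 Q24(a)), node U5c / U5.E, spine estimate
NE7b, renewal member; kernel bookkeeping, Mathlib + `T4WeightBudget` only; census item v19 of `t4/T4-EST-NE7b-P2.md`)

HONEST FRAMING (T4-DAG PAGE 1).  The cell's T4 target is the existence and uniqueness of the `ε → 0` limit of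
unit-scale block-averaged expectations on a FIXED finite torus, at rung (B)+1, CONDITIONAL on Bałaban's ultraviolet
stability (B) and on BetaPertH; it is NOT infinite volume, NOT the mass gap, NOT the Clay problem.  This module is
[folklore] real analysis / finite combinatorics; NOTHING of Bałaban's is asserted — the shapes (G2), (G3), (G5) below
enter only as named hypotheses (`GlobalDom`), and the module says nothing about whether they hold for the (1.104)
family of [Balaban1989LargeFieldII].  Value = a RE-TYPING of which inequalities the weight slot of node U5c needs on a
fixed torus; NOT summit progress, NOT a proof of NE7b.

THE POINT (census v19 of the P2 lineage; for the t4-carver and the E2-rel owners to adjudicate).  The output shape of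
NE7b is RELATIVE (`T4WeightBudget.RelWeightBound`: in each run the bad class has relative weight `≤ W K`,
`Σ_K W K < ∞`).  The cell's instantiation chain for it (`T4WeightBudgetKP.PolymerDom` → `T4PeierlsDomination.PeierlsDom`
→ `T4HistoryPeeling.SlotDom` → `T4PersistenceRenewal.EventDom` / `T4PersistenceGrove` …) is FIBRE-RELATIVE: every bad
term is compared with its OWN sibling (the same history with one structure switched off), and the located unprinted
core of that comparison is CONDITIONAL — E2 / E2-rel (a) (relative locality of the exterior terms), E2-rel (b) (a
territory-conditional LOWER bound; `t4/T4-EST-U5Ea-E2relb.md` V1: no printed analogue), this lineage's raw relative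
prices `hraw` / `hraw₀` "context-uniformly at event resolution" (GAPS G-ne7bp2-1).  That design is forced in INFINITE or
GROWING volume, where absolute bounds lose `e^{O(volume)}`.  On a FIXED torus it is not: the relative bound follows from
  (G1) POSITIVITY of the term weights (interface I-2 of node U5.E — the cell's standing hypothesis, B16 p. 380 /
       FINAL-STATEMENT (f) L1-pos);
  (G2) a GLOBAL LOWER BOUND on each run's FULL sum, `nlow K t ≤ Σ_{τ ∈ T K} A K t τ` — the shape of the LOWER half of
       the end statement (B) itself ([Balaban1989LargeFieldII] Thm 1 (0.1) p. 355 = [Balaban1988Convergent] (cell paper B14)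
       Cor. 3 (2.50) p. 264, in the cell's reading FINAL-STATEMENT §1 display (0.1) / §5 (f):
       `χ_k·exp[−g_k^{−2}A(U_k(V)) − E₋|T_η|] ≤ ρ_k(V)`, `|T_η|` = the volume in unit-lattice units, `E₋ = E₋(g_k)` with
       the PINNED clause of `B14Cor3` Cor. 3 (2.50) «depending on g_k» (T4-DAG §0 H1, FINAL-STATEMENT §6d: the pin is
       `Cor3_250`, NOT the k-uniform reading `UVBound01`, refuted for log-normalised ρ₀) — used here at the FINAL scale
       `k = K` only, where `g_K = g` is fixed by T4-DAG D3 (IR-matched runs), so `E₋(g_K) = E₋(g)` is `K`-uniform for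
       that reason (v1.1, XREAD C-adv4-95 DOCFIX 1)), integrated against the source; (B) is a HYPOTHESIS of the T4 cell,
       and the cell records that the d = 4 DERIVATION of this lower half is NOT in print (FINAL-STATEMENT §5 (f), GAPS
       G-adv3-2) — the route below therefore leans on (B)'s lower half BY NAME and on nothing local.  DOCKET FLAG
       (v1.1, XREAD C-adv4-95 DESIGN-FLAG, for the t4-carver): this is true of the BINDER (the tree pin
       `B16.EndStatementBPrinted := Thm1Printed ∧ Cor3_250` is two-sided) but NOT of the cell's present DOCKET —
       T4-DAG §0 H1 confines the use of (B)'s LOWER half «only in the optional node E4»; adopting this re-typing puts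
       it on the UNIQUENESS SPINE (node U5c via (G2)/(G5)) and trades the relative route's unprinted core (E2, E2-rel
       (a)/(b), `hraw`/`hraw₀`) for the rest of GAPS G-adv3-2 (L1-real + the lower-bound derivation proper; L1-pos is
       already on the spine by D7) — H1 must be amended if the cell adopts it; nothing here pre-empts that ruling;
  (G3) ABSOLUTE UPPER BOUNDS on the bad terms, `A K t τ ≤ F K τ · nup K t` for `τ ∈ Bad K t`, with `F K τ` a product
       of per-event factors along the term's OWN history — the currency in which print works: per pending component
       [Balaban1989LargeFieldII] (1.79) p. 383, (1.80) p. 384, (1.85)–(1.89) pp. 385–388 (absolute, `κ ≥ 0` netting), the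
       absolute action bounds of [B14] Thm 2 (2.43)/(2.44) p. 263 and (2.47)–(2.49) pp. 263–264 [P, pointers only; no
       sentence is quoted here]; the UNPRINTED part of (G3) is the cell's R1 (the banked re-cut of (1.88), so that `F`
       keeps a per-EVENT-decaying fraction of each renewal factor — the conversion of event count into AGE decay is R2,
       consumed in (G4), not here; `t4/T4-EST-U5c.md` §0; v1.1 wording, XREAD C-adv4-95 INFO) and the (ID) dictionary of the
       sibling lineage t4-ne7b-p1 (`T4PersistenceDictionary`) — and NO lower bound, NO conditional comparison;
  (G4) the MODEL ENTROPY SUM `Σ_{τ ∈ Bad K t} F K τ ≤ M K` (pure counting × prices: §2 below for a product gas; the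
       renewal-chain / records arithmetic of `T4RenewalChains`, `T4RecordChains`, `T4PersistentHistoryCount` in general);
  (G5) COMPARABLE NORMALISATIONS `nup K t ≤ C · nlow K t` with ONE constant `C` — in the intended application
       `C = e^{(E₊ + E₋ + c)·vol}·C_src`, VOLUME-DEPENDENT and `K`-UNIFORM: up to the factors `e^{±E_± vol}` of (B) and the
       bounded source `e^{±l₀‖O‖}`, both normalisations are unit-lattice integrals of `e^{−A(U_K(V))/g_K²}` over the
       compact group, WITH (lower) / WITHOUT (upper) the small-field constraint `χ_K` (this describes the SHARPER upper
       normalisation of [B14] Thm 2 (2.43)/(2.44) type; with (0.1)'s own printed upper half `ρ_k ≤ exp(E₊|T_η|)`, which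
       carries NO action factor, one simply takes `nup = e^{E₊·vol}·C_src` and (G5) reads
       `e^{(E₊+E₋)·vol}·C_src ≤ C·∫ χ_K e^{−A(U_K(V))/g_K²} dV` — v1.1, XREAD C-adv4-95 INFO), and their ratio is
       `K`-uniform once the constrained integral is bounded below uniformly in `K` (at `g_K = g`, D3) — a
       fixed-dimensional statement on a FIXED finite lattice which the instantiating seat must supply together with
       (G2)/(G3); NOTHING of it is asserted here —
giving `Σ_{Bad} A ≤ (C · M K) · Σ_T A` (`GlobalDom.sum_bad_le`), hence `RelWeightBound` with `W K = C · M K` from the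
first `K₀` with `C · M K < 1` on, bad classes emptied below `K₀` (`relWeightBound_of_globalDom`, via
`T4WeightBudget.relWeightBound_of_eventually`; early `K` are the one-class instance, T4-DAG §2 U5c).  The price of the
route is the constant `e^{c·vol}` inside `W K`: it delays `K₀` and is invisible in `Σ_K W K < ∞`; only an
infinite-volume statement — out of the cell's scope — would forbid it.  The cell's own expected profile
`W K ≤ vol · r^{K − j⋆(K) + 1}/(1 − r)` (T4-DAG §2 U5c I-1) is already volume-dependent.
WHAT THIS RE-TYPING REMOVES, IF ADOPTED: the relative / conditional / territory-local comparisons (R3's unprinted core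
E2, E2-rel (a), E2-rel (b)/(N), `hraw`/`hraw₀` context-uniformity) from the list of inputs of the U5c weight slot at
fixed volume.  WHAT IT DOES NOT REMOVE: R1 (banked re-cut), R2 (window reading), R4/(ID) (entropy and dictionary),
positivity I-2, and the dependence on (B) INCLUDING its lower half.  WHAT IT DOES NOT TOUCH: the term-wise matching of
the GOOD class (nodes U4′/U5b, NE7b-rem), node U5d, BetaPertH.  Whether (G3) with an age-decaying `F` is derivable from
the printed induction plus R1 is EXACTLY the question the cell already lists under R1 — not a new estimate.

CONTENTS.  §1 `GlobalDom` (one run: (G2) ∧ (G3) ∧ (G5) from a threshold `K₀` on) ⇒ `GlobalDom.sum_bad_le`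
⇒ `relWeightBound_of_globalDom` (two runs + (G4) + `C·M K < 1` for `K ≥ K₀` + `Σ M < ∞`) and the threshold-free
corollary `exists_relWeightBound_of_globalDom` (a summable budget is eventually below `1/C`).  §2 (G4) for a PRODUCT
GAS over finitely many slots (`gasWeight q τ = ∏_s q s (τ s)` on `Fintype.piFinset vals`): the total mass is the product
of the slot masses (`sum_gasWeight_eq`), the mass of the terms pending at one slot factorises
(`sum_gasWeight_filter_mem_eq`), and the ABSOLUTE bad mass (some old slot pending) is at most
(old pending mass) × exp(total slot excess) (`sum_bad_gasWeight_le`, `sum_bad_gasWeight_le_mul_exp`) — the absolute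
twin of the relative same-family bound `T4PeierlsDomination.sum_bad_le_weight_mul_total`.  §3 a decided toy
(`globalDom_toy`, `relWeightBound_toy`): every hypothesis of `relWeightBound_of_globalDom` at once, non-vacuously.

References (locators only): [Balaban1989LargeFieldII] = CMP 122 (1989) 355–392, Thm 1 (0.1) p. 355, (1.79) p. 383,
(1.80) p. 384, (1.85)–(1.89) pp. 385–388, (1.104) p. 391; [B14] = [Balaban1988Convergent] = CMP 119 (1988) 243–285
(Thm 2 (2.43)/(2.44) p. 263, (2.47)–(2.50) pp. 263–264) — as read in `FINAL-STATEMENT.md` §1 / §5 (f), `B14Cor3.lean` and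
`t4/T4-EST-U5c.md`; nothing re-quoted.

v1.1 (2026-08-19, same seat) — DOCSTRING-ONLY, every declaration byte-identical to v1 (p187856): the three DOCFIX items and
two INFO wordings of the cross-read by referee-b2b-balaban-adv4-g50-0 (XREAD `HOME/b2b-balaban-adv4/g50/XREAD-T4GlobalDenominator-v1.md`,
GAPS C-adv4-95; verdict ok CONSISTENT, ABSOLUTE-RULE 0, killing objections 0) folded: (G2)'s `E₋` clause is the pinned
`Cor3_250` one («depending on g_k»), K-uniform at the final scale by D3, not (0.1)'s «independent of k»; (1.80) is on
p. 384; FINAL-STATEMENT locators are §1 (display) / §5 (f); the (G3) «age-decaying» wording separated into R1 (per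
event) and R2 (age, in (G4)); the (G5) gloss distinguishes (0.1)'s action-free upper half from the sharper B14 Thm 2
normalisation; and the reader's DESIGN-FLAG (T4-DAG §0 H1 confines (B)'s lower half to the optional node E4 — adopting
this re-typing moves it onto the uniqueness spine; H1 to be amended by the carver if adopted) is now recorded in (G2).
Also noted from the read: the field `GlobalDom.F_nonneg` is not used by `GlobalDom.sum_bad_le`'s calc (carried for
instantiators only).
-/

open Finset _root_.Filter _root_.Topology

namespace Literature.MathematicalPhysics.QuantumFieldTheory.Balaban1983to89.T4GlobalDenominator

open T4WeightBudget

/-! ## §1 The extraction: absolute bad bounds ÷ global lower bound ⇒ relative weight bound -/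

section Extraction

variable {ι : Type*} {l₀ : ℝ} {T : ℕ → Finset ι} {A B : ℕ → ℝ → ι → ℝ} {Bad : ℕ → ℝ → Finset ι}
  {F G : ℕ → ι → ℝ} {nlow nup mlow mup : ℕ → ℝ → ℝ} {C : ℝ} {K₀ : ℕ} {M : ℕ → ℝ}

/-- NAMED HYPOTHESIS SHAPE `GlobalDom l₀ T A Bad F nlow nup C K₀` (ONE run; census v19 of the P2 lineage; NOT a printed
statement, NOT asserted): from the threshold `K₀` on and for every `|t| ≤ l₀` — the bad class consists of terms;
(G2) the FULL sum is bounded BELOW by a normalisation `nlow K t`; (G3) every bad term is bounded ABOVE by its history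
factor `F K τ ≥ 0` times a normalisation `nup K t ≥ 0`; (G5) the two normalisations are comparable with ONE constant,
`nup K t ≤ C · nlow K t` (`C` volume-dependent, `K`-uniform in the application).  No lower bound on any individual
term, no comparison between two terms, no conditioning.  (A hypothesis SHAPE; the tag refers to the packaging only.)
[folklore] -/
structure GlobalDom (l₀ : ℝ) (T : ℕ → Finset ι) (A : ℕ → ℝ → ι → ℝ) (Bad : ℕ → ℝ → Finset ι)
    (F : ℕ → ι → ℝ) (nlow nup : ℕ → ℝ → ℝ) (C : ℝ) (K₀ : ℕ) : Prop where
  /-- the bad class consists of terms -/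
  bad_subset : ∀ K t, |t| ≤ l₀ → K₀ ≤ K → Bad K t ⊆ T K
  /-- (G2) global lower bound on the full sum -/
  low : ∀ K t, |t| ≤ l₀ → K₀ ≤ K → nlow K t ≤ ∑ τ ∈ T K, A K t τ
  /-- (G3) absolute upper bound on each bad term: history factor × normalisation -/
  up : ∀ K t, |t| ≤ l₀ → K₀ ≤ K → ∀ τ ∈ Bad K t, A K t τ ≤ F K τ * nup K t
  /-- the history factors are nonnegative on the bad class -/
  F_nonneg : ∀ K t, |t| ≤ l₀ → K₀ ≤ K → ∀ τ ∈ Bad K t, 0 ≤ F K τ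
  /-- the upper normalisation is nonnegative -/
  nup_nonneg : ∀ K t, |t| ≤ l₀ → K₀ ≤ K → 0 ≤ nup K t
  /-- (G5) the two normalisations are comparable with one constant -/
  ratio : ∀ K t, |t| ≤ l₀ → K₀ ≤ K → nup K t ≤ C * nlow K t

/-- **THE EXTRACTION (one run).**  `GlobalDom` + the model entropy sum (G4) `Σ_{Bad} F ≤ M K` with `0 ≤ M K`, `0 ≤ C`
⇒ the bad class has relative weight `≤ C · M K` from `K₀` on:
`Σ_{Bad} A ≤ Σ_{Bad} F·nup = nup·Σ_{Bad} F ≤ nup·M ≤ C·nlow·M ≤ (C·M)·Σ_T A`. [folklore] -/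
theorem GlobalDom.sum_bad_le (h : GlobalDom l₀ T A Bad F nlow nup C K₀) (hC : 0 ≤ C)
    (hM0 : ∀ K, K₀ ≤ K → 0 ≤ M K) (hF : ∀ K t, |t| ≤ l₀ → K₀ ≤ K → ∑ τ ∈ Bad K t, F K τ ≤ M K)
    {K : ℕ} {t : ℝ} (ht : |t| ≤ l₀) (hK : K₀ ≤ K) :
    ∑ τ ∈ Bad K t, A K t τ ≤ (C * M K) * ∑ τ ∈ T K, A K t τ := by
  have hnup := h.nup_nonneg K t ht hK
  calc ∑ τ ∈ Bad K t, A K t τ ≤ ∑ τ ∈ Bad K t, F K τ * nup K t := Finset.sum_le_sum (h.up K t ht hK)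
    _ = (∑ τ ∈ Bad K t, F K τ) * nup K t := by rw [Finset.sum_mul]
    _ ≤ M K * nup K t := mul_le_mul_of_nonneg_right (hF K t ht hK) hnup
    _ ≤ M K * (C * nlow K t) := mul_le_mul_of_nonneg_left (h.ratio K t ht hK) (hM0 K hK)
    _ = (C * M K) * nlow K t := by ring
    _ ≤ (C * M K) * ∑ τ ∈ T K, A K t τ :=
        mul_le_mul_of_nonneg_left (h.low K t ht hK) (mul_nonneg hC (hM0 K hK))

/-- **THE EXTRACTION (two runs) ⇒ NE7b's OUTPUT SHAPE.**  If BOTH runs satisfy `GlobalDom` from `K₀` on (each with its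
own history factors and normalisations, a common constant `C ≥ 0` — take the larger one), the model entropy sums obey
(G4) `Σ_{Bad} F ≤ M K`, `Σ_{Bad} G ≤ M K` with a common budget `0 ≤ M K`, `C · M K < 1` for `K ≥ K₀` and `Σ_K M K < ∞`,
then `RelWeightBound` holds with the bad classes EMPTIED below `K₀` and `W K = C · M K` from `K₀` on (early `K`: the
one-class instance, `T4WeightBudget.relWeightBound_of_eventually`).  No relative, conditional or territory-local
comparison is among the hypotheses. [folklore] -/
theorem relWeightBound_of_globalDom (hA : GlobalDom l₀ T A Bad F nlow nup C K₀)
    (hB : GlobalDom l₀ T B Bad G mlow mup C K₀) (hC : 0 ≤ C) (hM0 : ∀ K, K₀ ≤ K → 0 ≤ M K)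
    (hF : ∀ K t, |t| ≤ l₀ → K₀ ≤ K → ∑ τ ∈ Bad K t, F K τ ≤ M K)
    (hG : ∀ K t, |t| ≤ l₀ → K₀ ≤ K → ∑ τ ∈ Bad K t, G K τ ≤ M K)
    (hM1 : ∀ K, K₀ ≤ K → C * M K < 1) (hMs : Summable M) :
    RelWeightBound l₀ T A B (fun K t => if K₀ ≤ K then Bad K t else ∅)
      (Set.indicator {K | K₀ ≤ K} (fun K => C * M K)) :=
  relWeightBound_of_eventually hA.bad_subset (fun K hK => mul_nonneg hC (hM0 K hK)) hM1 (hMs.mul_left C)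
    (fun _ _ ht hK => hA.sum_bad_le hC hM0 hF ht hK) (fun _ _ ht hK => hB.sum_bad_le hC hM0 hG ht hK)

/-- `GlobalDom` from `K₀` on restricts to any later threshold. [folklore] -/
theorem GlobalDom.of_le (h : GlobalDom l₀ T A Bad F nlow nup C K₀) {K₁ : ℕ} (h01 : K₀ ≤ K₁) :
    GlobalDom l₀ T A Bad F nlow nup C K₁ where
  bad_subset K t ht hK := h.bad_subset K t ht (h01.trans hK)
  low K t ht hK := h.low K t ht (h01.trans hK)
  up K t ht hK := h.up K t ht (h01.trans hK)
  F_nonneg K t ht hK := h.F_nonneg K t ht (h01.trans hK)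
  nup_nonneg K t ht hK := h.nup_nonneg K t ht (h01.trans hK)
  ratio K t ht hK := h.ratio K t ht (h01.trans hK)

/-- **THRESHOLD-FREE COROLLARY.**  With a NONNEGATIVE SUMMABLE budget `M` (so `M K → 0`) the condition `C · M K < 1`
holds from some `K₁ ≥ K₀` on by itself; hence two-run `GlobalDom` + (G4) give SOME `RelWeightBound` (bad classes
emptied below `K₁`, `W = 𝟙_{K ≥ K₁}·C·M`).  The size of `C` (e.g. `e^{c·vol}`) only moves `K₁`. [folklore] -/
theorem exists_relWeightBound_of_globalDom (hA : GlobalDom l₀ T A Bad F nlow nup C K₀)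
    (hB : GlobalDom l₀ T B Bad G mlow mup C K₀) (hC : 0 ≤ C) (hM0 : ∀ K, 0 ≤ M K)
    (hF : ∀ K t, |t| ≤ l₀ → K₀ ≤ K → ∑ τ ∈ Bad K t, F K τ ≤ M K)
    (hG : ∀ K t, |t| ≤ l₀ → K₀ ≤ K → ∑ τ ∈ Bad K t, G K τ ≤ M K) (hMs : Summable M) :
    ∃ K₁, K₀ ≤ K₁ ∧ RelWeightBound l₀ T A B (fun K t => if K₁ ≤ K then Bad K t else ∅)
      (Set.indicator {K | K₁ ≤ K} (fun K => C * M K)) := by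
  -- `C · M K → 0`, so eventually `< 1`
  have hlim : Tendsto (fun K => C * M K) atTop (𝓝 0) := by
    simpa using (hMs.tendsto_atTop_zero).const_mul C
  obtain ⟨K₂, hK₂⟩ := eventually_atTop.1 (hlim.eventually (gt_mem_nhds one_pos))
  refine ⟨max K₀ K₂, le_max_left _ _, ?_⟩
  exact relWeightBound_of_globalDom (hA.of_le (le_max_left _ _)) (hB.of_le (le_max_left _ _)) hC
    (fun K _ => hM0 K) (fun K t ht hK => hF K t ht ((le_max_left _ _).trans hK))
    (fun K t ht hK => hG K t ht ((le_max_left _ _).trans hK))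
    (fun K hK => hK₂ K ((le_max_right _ _).trans hK)) hMs

end Extraction

/-! ## §2 (G4) for a product gas: the absolute bad mass is (old pending mass) × (total mass) -/

section Gas

variable {σ V : Type*} [Fintype σ] [DecidableEq σ] [DecidableEq V]

/-- The multiplicative weight of a configuration of a product gas: the product of the slot prices. [folklore] -/
def gasWeight (q : σ → V → ℝ) (τ : σ → V) : ℝ := ∏ s, q s (τ s)

omit [DecidableEq σ] [DecidableEq V] in
/-- gas weights are nonnegative for nonnegative prices [folklore] -/
theorem gasWeight_nonneg {q : σ → V → ℝ} (hq : ∀ s v, 0 ≤ q s v) (τ : σ → V) : 0 ≤ gasWeight q τ :=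
  Finset.prod_nonneg fun s _ => hq s (τ s)

omit [DecidableEq V] in
/-- **TOTAL MASS = PRODUCT OF SLOT MASSES** over the admissible configurations `Fintype.piFinset vals`. [folklore] -/
theorem sum_gasWeight_eq (vals : σ → Finset V) (q : σ → V → ℝ) :
    ∑ τ ∈ Fintype.piFinset vals, gasWeight q τ = ∏ s, ∑ v ∈ vals s, q s v := by
  unfold gasWeight
  rw [Finset.prod_univ_sum]

/-- **THE MASS OF THE CONFIGURATIONS PENDING AT ONE SLOT FACTORISES**: restricting slot `s` to the values `P ⊆ vals s`
gives (the `P`-mass of slot `s`) × (the product of the other slot masses). [folklore] -/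
theorem sum_gasWeight_filter_mem_eq (vals : σ → Finset V) (q : σ → V → ℝ) (s : σ) {P : Finset V}
    (hP : P ⊆ vals s) :
    ∑ τ ∈ (Fintype.piFinset vals).filter (fun τ => τ s ∈ P), gasWeight q τ
      = (∑ v ∈ P, q s v) * ∏ s' ∈ univ.erase s, ∑ v ∈ vals s', q s' v := by
  rw [← Fintype.piFinset_update_eq_filter_piFinset_mem vals s hP, sum_gasWeight_eq,
    ← Finset.mul_prod_erase univ _ (mem_univ s), Function.update_self]
  congr 1
  exact Finset.prod_congr rfl fun s' hs' => by rw [Function.update_of_ne (Finset.ne_of_mem_erase hs')]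

/-- **ABSOLUTE BAD MASS OF A PRODUCT GAS (union bound).**  If the bad configurations are those pending at SOME old slot
`s ∈ S₀` (value in `P s ⊆ vals s`), then for nonnegative prices
`Σ_{Bad} gasWeight ≤ Σ_{s ∈ S₀} (P-mass of s) · ∏_{s' ≠ s} (mass of s')`. [folklore] -/
theorem sum_bad_gasWeight_le (vals : σ → Finset V) {q : σ → V → ℝ} (hq : ∀ s v, 0 ≤ q s v) (S₀ : Finset σ)
    {P : σ → Finset V} (hP : ∀ s, P s ⊆ vals s) {Bad : Finset (σ → V)}
    (hBad : Bad ⊆ S₀.biUnion fun s => (Fintype.piFinset vals).filter (fun τ => τ s ∈ P s)) :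
    ∑ τ ∈ Bad, gasWeight q τ ≤ ∑ s ∈ S₀, (∑ v ∈ P s, q s v) * ∏ s' ∈ univ.erase s, ∑ v ∈ vals s', q s' v :=
  calc ∑ τ ∈ Bad, gasWeight q τ
        ≤ ∑ τ ∈ S₀.biUnion (fun s => (Fintype.piFinset vals).filter (fun τ => τ s ∈ P s)), gasWeight q τ :=
          Finset.sum_le_sum_of_subset_of_nonneg hBad fun τ _ _ => gasWeight_nonneg hq τ
    _ ≤ ∑ s ∈ S₀, ∑ τ ∈ (Fintype.piFinset vals).filter (fun τ => τ s ∈ P s), gasWeight q τ :=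
          sum_biUnion_le_sum S₀ _ (gasWeight_nonneg hq)
    _ = ∑ s ∈ S₀, (∑ v ∈ P s, q s v) * ∏ s' ∈ univ.erase s, ∑ v ∈ vals s', q s' v :=
          Finset.sum_congr rfl fun s _ => sum_gasWeight_filter_mem_eq vals q s (hP s)

/-- **… × exp(TOTAL EXCESS).**  If every slot mass is at most `exp (m s)` with `m s ≥ 0` (e.g. an empty value of price
`1` plus a pending mass `m s`: `1 + m s ≤ e^{m s}`), the absolute bad mass is at most
(old pending mass) · `exp (Σ_s m s)` — `K`-uniform as soon as the total excess `Σ_s m s` is (in the application: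
`≤ c·vol` by the geometric age sum). [folklore] -/
theorem sum_bad_gasWeight_le_mul_exp (vals : σ → Finset V) {q : σ → V → ℝ} (hq : ∀ s v, 0 ≤ q s v)
    (S₀ : Finset σ) {P : σ → Finset V} (hP : ∀ s, P s ⊆ vals s) {Bad : Finset (σ → V)}
    (hBad : Bad ⊆ S₀.biUnion fun s => (Fintype.piFinset vals).filter (fun τ => τ s ∈ P s))
    {m : σ → ℝ} (hm0 : ∀ s, 0 ≤ m s) (hm : ∀ s, ∑ v ∈ vals s, q s v ≤ Real.exp (m s)) :
    ∑ τ ∈ Bad, gasWeight q τ ≤ (∑ s ∈ S₀, ∑ v ∈ P s, q s v) * Real.exp (∑ s, m s) := by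
  have hprod : ∀ s, ∏ s' ∈ univ.erase s, ∑ v ∈ vals s', q s' v ≤ Real.exp (∑ s', m s') := fun s =>
    calc ∏ s' ∈ univ.erase s, ∑ v ∈ vals s', q s' v ≤ ∏ s' ∈ univ.erase s, Real.exp (m s') :=
          Finset.prod_le_prod (fun s' _ => Finset.sum_nonneg fun v _ => hq s' v) fun s' _ => hm s'
      _ = Real.exp (∑ s' ∈ univ.erase s, m s') := (Real.exp_sum _ _).symm
      _ ≤ Real.exp (∑ s', m s') := Real.exp_le_exp.2
          (Finset.sum_le_sum_of_subset_of_nonneg (Finset.erase_subset _ _) fun s' _ _ => hm0 s')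
  calc ∑ τ ∈ Bad, gasWeight q τ
        ≤ ∑ s ∈ S₀, (∑ v ∈ P s, q s v) * ∏ s' ∈ univ.erase s, ∑ v ∈ vals s', q s' v :=
          sum_bad_gasWeight_le vals hq S₀ hP hBad
    _ ≤ ∑ s ∈ S₀, (∑ v ∈ P s, q s v) * Real.exp (∑ s', m s') := Finset.sum_le_sum fun s _ =>
          mul_le_mul_of_nonneg_left (hprod s) (Finset.sum_nonneg fun v _ => hq s v)
    _ = (∑ s ∈ S₀, ∑ v ∈ P s, q s v) * Real.exp (∑ s, m s) := by rw [Finset.sum_mul]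

omit [Fintype σ] [DecidableEq σ] in
/-- The slot-mass hypothesis of `sum_bad_gasWeight_le_mul_exp` in the usual form: an EMPTY value `e` of price `1` and
the pending values `vals s ∖ {e}` of total price `≤ m s` give slot mass `≤ 1 + m s ≤ exp (m s)`. [folklore] -/
theorem slotMass_le_exp {vals : σ → Finset V} {q : σ → V → ℝ} {e : V} {m : σ → ℝ} (s : σ) (he : e ∈ vals s)
    (hqe : q s e = 1) (hm : ∑ v ∈ (vals s).erase e, q s v ≤ m s) :
    ∑ v ∈ vals s, q s v ≤ Real.exp (m s) := by
  rw [← Finset.add_sum_erase _ _ he, hqe]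
  calc 1 + ∑ v ∈ (vals s).erase e, q s v ≤ m s + 1 := by linarith
    _ ≤ Real.exp (m s) := Real.add_one_le_exp _

end Gas

/-! ## §3 A decided toy: every hypothesis of `relWeightBound_of_globalDom` at once -/

section Toy

/-- toy term weights on `Bool`: the good term `false` has weight `e^t`, the bad term `true` weight `e^t · 2^{−K}`
(a common `t`-dependent amplitude times a history factor) [folklore] -/
noncomputable def toyA (K : ℕ) (t : ℝ) (b : Bool) : ℝ := Real.exp t * (if b then (1 / 2 : ℝ) ^ K else 1)

/-- toy history factors [folklore] -/
noncomputable def toyF (K : ℕ) (b : Bool) : ℝ := if b then (1 / 2 : ℝ) ^ K else 1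

/-- The toy run satisfies `GlobalDom` with `nlow = nup = e^t`, `C = 1`, from `K₀ = 1` on: the full sum dominates the
good term `e^t` (positivity), the bad term equals `F · e^t`. [folklore] -/
theorem globalDom_toy (l₀ : ℝ) :
    GlobalDom l₀ (fun _ => (Finset.univ : Finset Bool)) toyA (fun _ _ => {true}) toyF
      (fun _ t => Real.exp t) (fun _ t => Real.exp t) 1 1 where
  bad_subset K t _ _ := Finset.subset_univ _
  low K t _ _ := by
    rw [Fintype.sum_bool]
    have h1 : 0 ≤ toyA K t true := mul_nonneg (Real.exp_nonneg t) (by positivity)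
    have h2 : toyA K t false = Real.exp t := by simp [toyA]
    linarith
  up K t _ _ τ hτ := by
    rw [Finset.mem_singleton] at hτ; subst hτ
    simp [toyA, toyF, mul_comm]
  F_nonneg K t _ _ τ _ := by unfold toyF; split_ifs <;> positivity
  nup_nonneg K t _ _ := Real.exp_nonneg t
  ratio K t _ _ := by rw [one_mul]

/-- … hence (both runs equal to the toy run, budget `M K = 2^{−K}`, `C = 1`, `K₀ = 1`) the output shape
`RelWeightBound` with `W K = 2^{−K}` for `K ≥ 1`. [folklore] -/
theorem relWeightBound_toy (l₀ : ℝ) :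
    RelWeightBound l₀ (fun _ => (Finset.univ : Finset Bool)) toyA toyA
      (fun K _ => if 1 ≤ K then ({true} : Finset Bool) else ∅)
      (Set.indicator {K | 1 ≤ K} (fun K => 1 * (1 / 2 : ℝ) ^ K)) := by
  have hF : ∀ (K : ℕ) (t : ℝ), |t| ≤ l₀ → 1 ≤ K → ∑ τ ∈ ({true} : Finset Bool), toyF K τ ≤ (1 / 2 : ℝ) ^ K := by
    intro K t _ _; simp [toyF]
  refine relWeightBound_of_globalDom (globalDom_toy l₀) (globalDom_toy l₀) zero_le_one
    (fun K _ => by positivity) hF hF (fun K hK => ?_) ?_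
  · rw [one_mul]; exact pow_lt_one₀ (by norm_num) (by norm_num) (by omega)
  · exact summable_geometric_of_lt_one (by norm_num) (by norm_num)

/-- the toy bad class is non-empty and positively weighted (non-vacuity) [folklore] -/
example (K : ℕ) (t : ℝ) : 0 < ∑ τ ∈ ({true} : Finset Bool), toyA K t τ := by
  simp only [Finset.sum_singleton, toyA, if_true]
  positivity

end Toy

end Literature.MathematicalPhysics.QuantumFieldTheory.Balaban1983to89.T4GlobalDenominator
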